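import Summits.BirchSwinnertonDyer.BirchSwinnertonDyer.Theorems.PrintX8VSInputHondaSystemSprungTowerGeneration
import HarnessLib

/-!
# The trace relations of Sprung's tower points as EQUALITIES of `E_Ω`-points (route `PrintX8VS` / `PrintX8`, support item
# `InputHondaSystem` = stmt-BirchSwinnertonDyer-20413, named fact `Sprung2012.thm22_exists_isHondaSystem`; file 12 of the local series)

HONEST FRAMING (desk `pub/bsd-wall/bsd-inputs`, seat `bsd-inputs-honda-p1`, D-0154 (2) INPUTS): THEOREMS ONLY — no definition, no
named fact, no instance, no `sorry`; closes nothing by itself; BSD is not proved by any of this.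

## Setting (files 4–5: `Ω = ℚ̄_p`, `E_Ω = genFibΩ p M`, `L(m)` = points with coordinates in `ℚ_p(ζ_m)`, `E₁ = kernel`, `Λ = ptLogΩ`)

For the Sprung sequence `x` (`x 0 = 1`, `p x 1 = a`, `p x (k+2) = a x (k+1) − x k`) and tower points `c m ∈ L(m) ∩ E₁` with
`Λ(c m) = ℓ_m = ∑_{k<m} x_k (ζ_{m−k} − 1)` (file 4), the combinations
`T_m := ∑_{q ∈ Stab(ζ_m)/Stab(ζ_{m+1})} q̃ ⋆ c_{m+1} − a•c_m + c_{m−1}` (`m ≥ 1`) and `T_0 := ∑_{q ∈ Γ/Stab(ζ_1)} q̃ ⋆ c_1` all have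
logarithm `−p` (file 5 proved `T_m ∈ L(0)`); since `Λ` is injective on the torsion-free `L(1) ∩ E₁`, **`T_m = T_0` for all `m ≥ 1`**:
the relations `Tr_{k_m/k_{m−1}} c_m = a c_{m−1} − c_{m−2} − Q` and `Tr_{k_0/ℚ_p} c_0 = −Q` of Sprung's Thm. 2.2 with ONE explicit
`ℚ_p`-rational error term `Q := −T_0 ∈ E₁(ℚ_p)`, `Λ(Q) = p` (absorbed into `c_{−1}` by the `Δ`-descent of the next files).

References: [Sprung2012] F. Sprung, J. Number Theory 132 (2012), Thm. 2.2 (p. 1487); [Kobayashi2003] S. Kobayashi, Invent. Math. 152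
(2003), Lemma 8.9, Prop. 8.7 (no `p`-torsion).
-/

set_option autoImplicit false
-- the Theorems namespace of this sub repeats the summit name by design (D-0017 nested layout)
set_option linter.dupNamespace false

noncomputable section

open scoped Classical Topology NNReal
open Filter PowerSeries Finset

namespace Summit.BirchSwinnertonDyer.BirchSwinnertonDyer.Theorems

namespace SprungHonda

open Summit.BirchSwinnertonDyer.Rank1Residual.Additive Summit.BirchSwinnertonDyer.Rank1Residual.Additive.BallEval
open Summit.BirchSwinnertonDyer.Rank1Residual.Additive.PadicCyclotomicTower
open Literature.NumberTheory.GaloisRepresentations.LubinTate (unitBall)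
open Literature.NumberTheory.EllipticCurves.FormalGroupChart (kernel val_zCoord_lt_one)
open WeierstrassCurve

variable {p : ℕ} [hp : Fact p.Prime] {M : WeierstrassCurve ℤ_[p]} [hE : (M.map PadicInt.Coe.ringHom).IsElliptic]
variable [hintΩ : (genFibΩ p M).IsIntegral (Valued.v (R := PadicAlgCl p)).integer]

/-- **`Λ` is injective on `L(m) ∩ E₁`** when `L(m)` has no `p`-power torsion. [cite: Kobayashi2003, Prop. 8.7 and Lemma 8.9] -/
theorem eq_of_ptLogΩ_eq {m : ℕ}
    (htors : ∀ Q ∈ subfieldPoints (genFibΩ p M) (layer p m).toSubfield coeffs_mem_layer, ∀ k : ℕ, p ^ k • Q = 0 → Q = 0)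
    {Q₁ Q₂ : (genFibΩ p M).toAffine.Point}
    (h₁ : Q₁ ∈ subfieldPoints (genFibΩ p M) (layer p m).toSubfield coeffs_mem_layer)
    (h₂ : Q₂ ∈ subfieldPoints (genFibΩ p M) (layer p m).toSubfield coeffs_mem_layer)
    (hk₁ : Q₁ ∈ kernel (Valued.v (R := PadicAlgCl p)) (genFibΩ p M)) (hk₂ : Q₂ ∈ kernel (Valued.v (R := PadicAlgCl p)) (genFibΩ p M))
    (hΛ : ptLogΩ p M Q₁ = ptLogΩ p M Q₂) : Q₁ = Q₂ := by
  haveI := isIntegral_curveK p (LayerField p m) M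
  have hsubL : Q₁ - Q₂ ∈ subfieldPoints (genFibΩ p M) (layer p m).toSubfield coeffs_mem_layer := (subfieldPoints _ _ _).sub_mem h₁ h₂
  have hsubk : Q₁ - Q₂ ∈ kernel (Valued.v (R := PadicAlgCl p)) (genFibΩ p M) :=
    (kernel (Valued.v (R := PadicAlgCl p)) (genFibΩ p M)).sub_mem hk₁ hk₂
  have h0 : ptLogΩ p M (Q₁ - Q₂) = 0 := by rw [ptLogΩ_sub (m := m) h₁ h₂ hk₁ hk₂, hΛ, sub_self]
  obtain ⟨k, hk⟩ := exists_pow_smul_eq_zero_of_ptLogΩ_eq_zero hsubL hsubk h0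
  exact sub_eq_zero.mp (htors _ hsubL k hk)

section Relations

variable {a : ℤ} {x : ℕ → ℚ_[p]}
  (act : Field.absoluteGaloisGroup ℚ_[p] → (genFibΩ p M).toAffine.Point → (genFibΩ p M).toAffine.Point)
  {c : ℕ → (genFibΩ p M).toAffine.Point}

/-- **`Λ(T_m) = −p`** (`m ≥ 1`): the logarithm of `∑_{q ∈ Stab(ζ_m)/Stab(ζ_{m+1})} q̃ ⋆ c_{m+1} − a•c_m + c_{m−1}` (file 4's trace
identity `∑ q̃•ℓ_{m+1} = −p + aℓ_m − ℓ_{m−1}`). [cite: Sprung2012, Thm. 2.2 (1)] [cite: Kobayashi2003, Lemma 8.9] -/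
theorem ptLogΩ_sum_act_sub_smul_add_sprung (hx0 : x 0 = 1) (hx1 : (p : ℚ_[p]) * x 1 = a)
    (hrec : ∀ k, (p : ℚ_[p]) * x (k + 2) = a * x (k + 1) - x k)
    (hact0 : ∀ σ, act σ 0 = 0)
    (hact : ∀ σ (x y : PadicAlgCl p) (h : (genFibΩ p M).toAffine.Nonsingular x y),
      ∃ h', act σ (Affine.Point.some x y h) = Affine.Point.some (σ • x) (σ • y) h')
    (hcL : ∀ n, c n ∈ subfieldPoints (genFibΩ p M) (layer p n).toSubfield coeffs_mem_layer)
    (hck : ∀ n, c n ∈ kernel (Valued.v (R := PadicAlgCl p)) (genFibΩ p M))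
    (hcΛ : ∀ n, ptLogΩ p M (c n) = ∑ k ∈ range n, algebraMap ℚ_[p] (PadicAlgCl p) (x k) * (zeta p (n - k) - 1))
    {m : ℕ} (hm : 1 ≤ m) [Fintype (stab p m ⧸ (stab p (m + 1)).subgroupOf (stab p m))] :
    ptLogΩ p M ((∑ q : stab p m ⧸ (stab p (m + 1)).subgroupOf (stab p m),
        act ((q.out : stab p m) : Field.absoluteGaloisGroup ℚ_[p]) (c (m + 1))) - a • c m + c (m - 1)) = -(p : PadicAlgCl p) := by
  haveI := isIntegral_curveK p (LayerField p (m + 1)) M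
  haveI := isIntegral_curveK p (LayerField p m) M
  have hcz : ‖(c (m + 1)).zCoord‖ < 1 := by
    have := val_zCoord_lt_one (hck (m + 1))
    rwa [PadicAlgCl.valuation_def, ← NNReal.coe_lt_coe, coe_nnnorm, NNReal.coe_one] at this
  have hSL : (∑ q : stab p m ⧸ (stab p (m + 1)).subgroupOf (stab p m),
      act ((q.out : stab p m) : Field.absoluteGaloisGroup ℚ_[p]) (c (m + 1))) ∈
      subfieldPoints (genFibΩ p M) (layer p (m + 1)).toSubfield coeffs_mem_layer :=
    (subfieldPoints _ _ _).sum_mem fun q _ ↦ act_mem_subfieldPoints act hact0 hact _ (hcL (m + 1))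
  have hSk : (∑ q : stab p m ⧸ (stab p (m + 1)).subgroupOf (stab p m),
      act ((q.out : stab p m) : Field.absoluteGaloisGroup ℚ_[p]) (c (m + 1))) ∈
      kernel (Valued.v (R := PadicAlgCl p)) (genFibΩ p M) :=
    (kernel (Valued.v (R := PadicAlgCl p)) (genFibΩ p M)).sum_mem fun q _ ↦ act_mem_kernel act hact0 hact _ (hck (m + 1))
  have hcmL : a • c m ∈ subfieldPoints (genFibΩ p M) (layer p (m + 1)).toSubfield coeffs_mem_layer :=
    (subfieldPoints _ _ _).zsmul_mem (subfieldPoints_layer_mono (Nat.le_succ m) (hcL m)) _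
  have hcmk : a • c m ∈ kernel (Valued.v (R := PadicAlgCl p)) (genFibΩ p M) :=
    (kernel (Valued.v (R := PadicAlgCl p)) (genFibΩ p M)).zsmul_mem (hck m) _
  have hc'L : c (m - 1) ∈ subfieldPoints (genFibΩ p M) (layer p (m + 1)).toSubfield coeffs_mem_layer :=
    subfieldPoints_layer_mono (by omega) (hcL (m - 1))
  rw [ptLogΩ_add (m := m + 1) ((subfieldPoints _ _ _).sub_mem hSL hcmL) hc'L
      ((kernel (Valued.v (R := PadicAlgCl p)) (genFibΩ p M)).sub_mem hSk hcmk) (hck (m - 1)),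
    ptLogΩ_sub (m := m + 1) hSL hcmL hSk hcmk,
    ptLogΩ_zsmul (m := m) (hcL m) (hck m),
    ptLogΩ_finset_sum (m := m + 1) _ _ (fun q _ ↦ act_mem_subfieldPoints act hact0 hact _ (hcL (m + 1)))
      (fun q _ ↦ act_mem_kernel act hact0 hact _ (hck (m + 1)))]
  simp_rw [ptLogΩ_act act hact0 hact _ hcz, hcΛ]
  rw [sum_smul_sprungEll_succ hx0 hx1 hrec hm]
  ring

/-- **`Λ(T_0) = −p`**: the logarithm of `∑_{q ∈ Γ/Stab(ζ_1)} q̃ ⋆ c_1` (`∑ q̃•(ζ_1 − 1) = −p`). [cite: Sprung2012, Thm. 2.2 (2)]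
[cite: Kobayashi2003, Lemma 8.9] -/
theorem ptLogΩ_sum_act_one_sprung (hx0 : x 0 = 1)
    (hact0 : ∀ σ, act σ 0 = 0)
    (hact : ∀ σ (x y : PadicAlgCl p) (h : (genFibΩ p M).toAffine.Nonsingular x y),
      ∃ h', act σ (Affine.Point.some x y h) = Affine.Point.some (σ • x) (σ • y) h')
    (hcL : ∀ n, c n ∈ subfieldPoints (genFibΩ p M) (layer p n).toSubfield coeffs_mem_layer)
    (hck : ∀ n, c n ∈ kernel (Valued.v (R := PadicAlgCl p)) (genFibΩ p M))
    (hcΛ : ∀ n, ptLogΩ p M (c n) = ∑ k ∈ range n, algebraMap ℚ_[p] (PadicAlgCl p) (x k) * (zeta p (n - k) - 1))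
    [Fintype (stab p 0 ⧸ (stab p 1).subgroupOf (stab p 0))] :
    ptLogΩ p M (∑ q : stab p 0 ⧸ (stab p 1).subgroupOf (stab p 0),
        act ((q.out : stab p 0) : Field.absoluteGaloisGroup ℚ_[p]) (c 1)) = -(p : PadicAlgCl p) := by
  haveI := isIntegral_curveK p (LayerField p 1) M
  have hcz : ‖(c 1).zCoord‖ < 1 := by
    have := val_zCoord_lt_one (hck 1)
    rwa [PadicAlgCl.valuation_def, ← NNReal.coe_lt_coe, coe_nnnorm, NNReal.coe_one] at this
  rw [ptLogΩ_finset_sum (m := 1) _ _ (fun q _ ↦ act_mem_subfieldPoints act hact0 hact _ (hcL 1))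
      (fun q _ ↦ act_mem_kernel act hact0 hact _ (hck 1))]
  simp_rw [ptLogΩ_act act hact0 hact _ hcz, hcΛ]
  exact sum_smul_sprungEll_one hx0

/-- **The relations of Thm. 2.2 as equalities of points**: for `m ≥ 1`,
`∑_{q ∈ Stab(ζ_m)/Stab(ζ_{m+1})} q̃ ⋆ c_{m+1} − a•c_m + c_{m−1} = ∑_{q ∈ Γ/Stab(ζ_1)} q̃ ⋆ c_1` (`= −Q`): both sides lie in
`L(0) ∩ E₁` (file 5) and have logarithm `−p`, and `Λ` is injective on the torsion-free `L(1) ∩ E₁`.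
[cite: Sprung2012, Thm. 2.2 (1), (2)] [cite: Kobayashi2003, Lemma 8.9] -/
theorem sum_act_sub_smul_add_eq_sum_act_one_sprung (hx0 : x 0 = 1) (hx1 : (p : ℚ_[p]) * x 1 = a)
    (hrec : ∀ k, (p : ℚ_[p]) * x (k + 2) = a * x (k + 1) - x k)
    (hact0 : ∀ σ, act σ 0 = 0)
    (hact : ∀ σ (x y : PadicAlgCl p) (h : (genFibΩ p M).toAffine.Nonsingular x y),
      ∃ h', act σ (Affine.Point.some x y h) = Affine.Point.some (σ • x) (σ • y) h')
    (hcL : ∀ n, c n ∈ subfieldPoints (genFibΩ p M) (layer p n).toSubfield coeffs_mem_layer)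
    (hck : ∀ n, c n ∈ kernel (Valued.v (R := PadicAlgCl p)) (genFibΩ p M))
    (hcΛ : ∀ n, ptLogΩ p M (c n) = ∑ k ∈ range n, algebraMap ℚ_[p] (PadicAlgCl p) (x k) * (zeta p (n - k) - 1))
    (htors : ∀ m, 1 ≤ m → ∀ Q ∈ subfieldPoints (genFibΩ p M) (layer p m).toSubfield coeffs_mem_layer,
      ∀ k : ℕ, p ^ k • Q = 0 → Q = 0)
    {m : ℕ} (hm : 1 ≤ m) [Fintype (stab p m ⧸ (stab p (m + 1)).subgroupOf (stab p m))]
    [Fintype (stab p 0 ⧸ (stab p 1).subgroupOf (stab p 0))] :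
    (∑ q : stab p m ⧸ (stab p (m + 1)).subgroupOf (stab p m),
        act ((q.out : stab p m) : Field.absoluteGaloisGroup ℚ_[p]) (c (m + 1))) - a • c m + c (m - 1) =
      ∑ q : stab p 0 ⧸ (stab p 1).subgroupOf (stab p 0), act ((q.out : stab p 0) : Field.absoluteGaloisGroup ℚ_[p]) (c 1) := by
  -- both sides lie in `L(0) ∩ E₁`
  have hL₁ := sum_act_sub_smul_add_mem_sprung hx0 hx1 hrec act hact0 hact hcL hck hcΛ hm (htors (m + 1) (by omega))
  have hL₂ := sum_act_one_mem_sprung hx0 act hact0 hact hcL hck hcΛ (htors 1 le_rfl)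
  have hk₁ : (∑ q : stab p m ⧸ (stab p (m + 1)).subgroupOf (stab p m),
      act ((q.out : stab p m) : Field.absoluteGaloisGroup ℚ_[p]) (c (m + 1))) - a • c m + c (m - 1) ∈
      kernel (Valued.v (R := PadicAlgCl p)) (genFibΩ p M) :=
    (kernel _ _).add_mem ((kernel _ _).sub_mem ((kernel _ _).sum_mem fun q _ ↦ act_mem_kernel act hact0 hact _ (hck (m + 1)))
      ((kernel _ _).zsmul_mem (hck m) _)) (hck (m - 1))
  have hk₂ : (∑ q : stab p 0 ⧸ (stab p 1).subgroupOf (stab p 0),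
      act ((q.out : stab p 0) : Field.absoluteGaloisGroup ℚ_[p]) (c 1)) ∈ kernel (Valued.v (R := PadicAlgCl p)) (genFibΩ p M) :=
    (kernel _ _).sum_mem fun q _ ↦ act_mem_kernel act hact0 hact _ (hck 1)
  refine eq_of_ptLogΩ_eq (m := 1) (htors 1 le_rfl) (subfieldPoints_layer_mono (Nat.zero_le 1) hL₁)
    (subfieldPoints_layer_mono (Nat.zero_le 1) hL₂) hk₁ hk₂ ?_
  rw [ptLogΩ_sum_act_sub_smul_add_sprung act hx0 hx1 hrec hact0 hact hcL hck hcΛ hm,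
    ptLogΩ_sum_act_one_sprung act hx0 hact0 hact hcL hck hcΛ]

/-- **`Λ(Q) = p`** for `Q := −∑_{q ∈ Γ/Stab(ζ_1)} q̃ ⋆ c_1 ∈ L(0) ∩ E₁`. [cite: Sprung2012, Thm. 2.2 (2)] -/
theorem ptLogΩ_neg_sum_act_one_sprung (hx0 : x 0 = 1)
    (hact0 : ∀ σ, act σ 0 = 0)
    (hact : ∀ σ (x y : PadicAlgCl p) (h : (genFibΩ p M).toAffine.Nonsingular x y),
      ∃ h', act σ (Affine.Point.some x y h) = Affine.Point.some (σ • x) (σ • y) h')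
    (hcL : ∀ n, c n ∈ subfieldPoints (genFibΩ p M) (layer p n).toSubfield coeffs_mem_layer)
    (hck : ∀ n, c n ∈ kernel (Valued.v (R := PadicAlgCl p)) (genFibΩ p M))
    (hcΛ : ∀ n, ptLogΩ p M (c n) = ∑ k ∈ range n, algebraMap ℚ_[p] (PadicAlgCl p) (x k) * (zeta p (n - k) - 1))
    [Fintype (stab p 0 ⧸ (stab p 1).subgroupOf (stab p 0))] :
    ptLogΩ p M (-(∑ q : stab p 0 ⧸ (stab p 1).subgroupOf (stab p 0),
        act ((q.out : stab p 0) : Field.absoluteGaloisGroup ℚ_[p]) (c 1))) = (p : PadicAlgCl p) := by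
  haveI := isIntegral_curveK p (LayerField p 1) M
  have hL : (∑ q : stab p 0 ⧸ (stab p 1).subgroupOf (stab p 0),
      act ((q.out : stab p 0) : Field.absoluteGaloisGroup ℚ_[p]) (c 1)) ∈
      subfieldPoints (genFibΩ p M) (layer p 1).toSubfield coeffs_mem_layer :=
    (subfieldPoints _ _ _).sum_mem fun q _ ↦ act_mem_subfieldPoints act hact0 hact _ (hcL 1)
  have hk : (∑ q : stab p 0 ⧸ (stab p 1).subgroupOf (stab p 0),
      act ((q.out : stab p 0) : Field.absoluteGaloisGroup ℚ_[p]) (c 1)) ∈ kernel (Valued.v (R := PadicAlgCl p)) (genFibΩ p M) :=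
    (kernel _ _).sum_mem fun q _ ↦ act_mem_kernel act hact0 hact _ (hck 1)
  rw [← neg_one_zsmul, ptLogΩ_zsmul (m := 1) hL hk, ptLogΩ_sum_act_one_sprung act hx0 hact0 hact hcL hck hcΛ]
  push_cast
  ring

end Relations

end SprungHonda

end Summit.BirchSwinnertonDyer.BirchSwinnertonDyer.Theorems

end
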